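import Summits.AnomalousDissipation.AnomalousDissipation.Theorems.SteadyCoherentFractionRootsPlanarWitnessField

/-!
# The crossed-shear root of Euler + drift + Kolmogorov force on `T³` — II: solenoidality, the steady equation, zero mean

For `v = (cos(4πx₁)/ρ(x₂), (cos(4πx₀) + c_K)ρ(x₂) - c_K, 0)`, `m = c_K e₁`, `p = sin(4πx₀) sin(4πx₁)`:
`div v = 0` (`isDivFree_vfield`), the classical steady Euler equation in drift form `(v·∇)v + Dv·m + ∇p = f_K`
pointwise (`crossedShear_momentum`; the `ρ`'s cancel and `4π c_K = -1`), and `∫ v = 0` (`hasZeroMean_vfield`: each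
component is a sum of partial derivatives of the smooth potentials `pot0`, `pot1`, `pot2`).
-/

noncomputable section

-- `Summit.<Summit>.<Problem>` is the tree's mandated summit-side namespace (CONVENTIONS §2); for this
-- single-conjunct summit the two segments coincide, so the duplicate is deliberate.
set_option linter.dupNamespace false

namespace Summit.AnomalousDissipation.AnomalousDissipation.Theorems.CrossedShearRoot

open Real MeasureTheory
open scoped InnerProductSpace
open Literature.Analysis.FunctionSpaces Literature.Analysis.FunctionSpaces.Torus Literature.Analysis.FluidPDE

/-! ## §6 Torus operators of the field -/

/-- `D_T v (proj y) a = D(lift v)(y) a` (`Torus.fderiv_lift`). [folklore] -/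
theorem torusFderiv_vfield_proj (y a : (EuclideanSpace ℝ (Fin 3))) :
    Torus.fderiv vfield (proj y) a =
      (fderiv ℝ (lift V0) y a) • EuclideanSpace.single (0 : Fin 3) (1 : ℝ) +
        (fderiv ℝ (lift V1) y a) • EuclideanSpace.single (1 : Fin 3) (1 : ℝ) := by
  rw [← fderiv_lift, fderiv_lift_vfield]

/-- Coordinates of the torus gradient at `proj y`: `(∇θ)(proj y) i = D(lift θ)(y) eᵢ`. [folklore] -/
theorem torusGradient_proj_apply (θ : (UnitAddTorus (Fin 3)) → ℝ) (y : (EuclideanSpace ℝ (Fin 3))) (i : Fin 3) :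
    Torus.gradient θ (proj y) i = fderiv ℝ (lift θ) y (EuclideanSpace.single i (1 : ℝ)) := by
  have h1 : Torus.gradient θ (proj y) = (InnerProductSpace.toDual ℝ (EuclideanSpace ℝ (Fin 3))).symm (fderiv ℝ (lift θ) y) := by
    rw [fderiv_lift]; rfl
  have h2 := InnerProductSpace.toDual_symm_apply (𝕜 := ℝ) (E := (EuclideanSpace ℝ (Fin 3))) (x := EuclideanSpace.single i (1 : ℝ))
    (y := fderiv ℝ (lift θ) y)
  rw [EuclideanSpace.inner_single_right] at h2
  rw [h1]
  simpa using h2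

/-- The values of `v` at `proj y`, coordinatewise. [folklore] -/
theorem vfield_proj_apply (y : (EuclideanSpace ℝ (Fin 3))) (i : Fin 3) :
    vfield (proj y) i = (if i = 0 then c4 (y 1) / rho (y 2) else 0) +
      (if i = 1 then (c4 (y 0) + cK) * rho (y 2) - cK else 0) := by
  have h := congrFun lift_vfield y
  rw [lift_apply] at h
  rw [h]
  simp only [PiLp.add_apply, PiLp.smul_apply, EuclideanSpace.single, PiLp.single_apply, smul_eq_mul, mul_ite,
    mul_one, mul_zero]

/-- The components of `v` as scalar functions. [folklore] -/
theorem vfield_apply_zero : (fun z => vfield z 0) = V0 := by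
  funext z; simp [vfield]

/-- The components of `v` as scalar functions. [folklore] -/
theorem vfield_apply_one : (fun z => vfield z 1) = V1 := by
  funext z; simp [vfield]

/-- The components of `v` as scalar functions. [folklore] -/
theorem vfield_apply_two : (fun z => vfield z 2) = fun _ => 0 := by
  funext z; simp [vfield]

/-- Partial derivatives of a smooth scalar function at `proj y` through the lift. [folklore] -/
theorem partialDeriv_proj {θ : (UnitAddTorus (Fin 3)) → ℝ} (hθ : IsSmooth θ) (i : Fin 3) (y : (EuclideanSpace ℝ (Fin 3))) :
    partialDeriv i θ (proj y) = fderiv ℝ (lift θ) y (EuclideanSpace.single i (1 : ℝ)) := by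
  rw [partialDeriv_eq_fderiv_apply (hθ.isContDiff (by simp)), fderiv_lift]

/-- A constant has vanishing partial derivatives. [folklore] -/
theorem partialDeriv_const_zero (i : Fin 3) (x : (UnitAddTorus (Fin 3))) : partialDeriv i (fun _ : (UnitAddTorus (Fin 3)) => (0 : ℝ)) x = 0 := by
  simp [Torus.partialDeriv, Torus.lineDeriv]

/-- `v` is divergence free: `∂₀v₀ = 0` (no `x₀`), `∂₁v₁ = 0` (no `x₁`), `v₂ = 0`. [folklore] -/
theorem isDivFree_vfield : IsDivFree vfield := by
  intro x
  obtain ⟨y, rfl⟩ := proj_surjective x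
  unfold divergence
  rw [Fin.sum_univ_three, vfield_apply_zero, vfield_apply_one, vfield_apply_two, partialDeriv_proj isSmooth_V0,
    partialDeriv_proj isSmooth_V1, partialDeriv_const_zero, fderiv_lift_V0, fderiv_lift_V1]
  simp [EuclideanSpace.single]

/-- **The classical steady equation in drift form**: `(v·∇)v + Dv·m + ∇p = f_K` pointwise on `T³`. [folklore] -/
theorem crossedShear_momentum (x : (UnitAddTorus (Fin 3))) :
    Torus.convect vfield vfield x + Torus.fderiv vfield x drift + Torus.gradient pres x = fK x := by
  obtain ⟨y, rfl⟩ := proj_surjective x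
  have hρ : rho (y 2) ≠ 0 := (rho_profile_pos _).1.ne'
  have hv : vfield (proj y) = lift vfield y := (lift_apply vfield y).symm
  have hf : fK (proj y) = lift fK y := (lift_apply fK y).symm
  unfold Torus.convect
  ext i
  rw [hf, lift_fK]
  simp only [PiLp.add_apply, torusFderiv_vfield_proj, torusGradient_proj_apply, fderiv_lift_V0, fderiv_lift_V1,
    fderiv_lift_pres, vfield_proj_apply, drift, PiLp.smul_apply, EuclideanSpace.single, PiLp.single_apply, smul_eq_mul]
  have hK := four_pi_mul_cK
  fin_cases i
  · simp
    field_simp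
    linear_combination (-(s4 (y 1) * rho (y 2))) * hK
  · simp
    field_simp
    ring
  · simp


/-! ## §7 Zero mean (the components are partial derivatives of smooth potentials) -/

/-- `s2` is `1`-periodic. [folklore] -/
theorem s2_periodic : Function.Periodic s2 1 := fun t => by
  unfold s2
  rw [show 2 * π * (t + 1) = 2 * π * t + 2 * π by ring, Real.sin_add_two_pi]

/-- `s2' = 2π cos(2π·)`. [folklore] -/
theorem hasDerivAt_s2 (t : ℝ) : HasDerivAt s2 (2 * π * Real.cos (2 * π * t)) t := by
  have h1 : HasDerivAt (fun t : ℝ => 2 * π * t) (2 * π) t := by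
    simpa using (hasDerivAt_id t).const_mul (2 * π)
  have h2 := (Real.hasDerivAt_sin (2 * π * t)).comp t h1
  unfold s2
  exact h2.congr_deriv (by ring)

/-- `s2` is smooth. [folklore] -/
theorem contDiff_s2_profile {n : WithTop ℕ∞} : ContDiff ℝ n s2 :=
  Real.contDiff_sin.comp (contDiff_const.mul contDiff_id)

/-- Lift of `Φ₀`. [folklore] -/
theorem lift_pot0 : lift pot0 = fun y : (EuclideanSpace ℝ (Fin 3)) => s4 (y 1) / (4 * π) / rho (y 2) := by
  funext y; rw [lift_apply]; unfold pot0; rw [coordFun_proj s4_periodic, coordFun_proj rho_periodic]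

/-- Lift of `Φ₁`. [folklore] -/
theorem lift_pot1 : lift pot1 = fun y : (EuclideanSpace ℝ (Fin 3)) => s4 (y 0) * rho (y 2) / (4 * π) := by
  funext y; rw [lift_apply]; unfold pot1; rw [coordFun_proj s4_periodic, coordFun_proj rho_periodic]

/-- Lift of `Φ₂`. [folklore] -/
theorem lift_pot2 : lift pot2 = fun y : (EuclideanSpace ℝ (Fin 3)) => cK * s2 (y 2) / (4 * π) := by
  funext y; rw [lift_apply]; unfold pot2; rw [coordFun_proj s2_periodic]

/-- `Φ₀` is smooth. [folklore] -/
theorem isSmooth_pot0 : IsSmooth pot0 := by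
  unfold IsSmooth; rw [lift_pot0]
  exact ((contDiff_profiles.2.1.comp (contDiff_piLp_apply (𝕜 := ℝ) (p := 2) (E := fun _ : Fin 3 => ℝ) (i := 1))).div_const _).div (contDiff_profiles.2.2.comp (contDiff_piLp_apply (𝕜 := ℝ) (p := 2) (E := fun _ : Fin 3 => ℝ) (i := 2)))
    fun y => (rho_profile_pos _).1.ne'

/-- `Φ₁` is smooth. [folklore] -/
theorem isSmooth_pot1 : IsSmooth pot1 := by
  unfold IsSmooth; rw [lift_pot1]
  exact ((contDiff_profiles.2.1.comp (contDiff_piLp_apply (𝕜 := ℝ) (p := 2) (E := fun _ : Fin 3 => ℝ) (i := 0))).mul (contDiff_profiles.2.2.comp (contDiff_piLp_apply (𝕜 := ℝ) (p := 2) (E := fun _ : Fin 3 => ℝ) (i := 2)))).div_const _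

/-- `Φ₂` is smooth. [folklore] -/
theorem isSmooth_pot2 : IsSmooth pot2 := by
  unfold IsSmooth; rw [lift_pot2]
  exact (contDiff_const.mul (contDiff_s2_profile.comp (contDiff_piLp_apply (𝕜 := ℝ) (p := 2) (E := fun _ : Fin 3 => ℝ) (i := 2)))).div_const _

/-- `∂₁Φ₀ = v₀`. [folklore] -/
theorem partialDeriv_pot0 : partialDeriv 1 pot0 = V0 := by
  funext x
  obtain ⟨y, rfl⟩ := proj_surjective x
  have hρ : rho (y 2) ≠ 0 := (rho_profile_pos _).1.ne'
  have hπ : (4 : ℝ) * π ≠ 0 := by positivity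
  rw [partialDeriv_proj isSmooth_pot0, ← lift_apply V0, lift_V0]
  have h1 := ((hasDerivAt_s4 (y 1)).comp_hasFDerivAt y (hasFDerivAt_coord 1 y)).mul_const ((4 * π)⁻¹)
  have h2 := (hasDerivAt_rho (y 2)).comp_hasFDerivAt y (hasFDerivAt_coord 2 y)
  have h3 := (hasDerivAt_inv hρ).comp_hasFDerivAt y h2
  have key := (h1.mul h3).congr_of_eventuallyEq (f₁ := lift pot0)
    (Filter.Eventually.of_forall fun z => by
      simp only [lift_pot0, Pi.mul_apply, Function.comp_apply]; ring)
  rw [key.fderiv]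
  simp only [add_apply, smul_apply, PiLp.proj_apply, smul_eq_mul, Function.comp_apply, EuclideanSpace.single,
    PiLp.single_apply]
  simp
  field_simp

/-- `∂₀Φ₁ (proj y) = cos(4πy₀)ρ(y₂)`. [folklore] -/
theorem partialDeriv_pot1 (y : (EuclideanSpace ℝ (Fin 3))) : partialDeriv 0 pot1 (proj y) = c4 (y 0) * rho (y 2) := by
  have hπ : (4 : ℝ) * π ≠ 0 := by positivity
  rw [partialDeriv_proj isSmooth_pot1]
  have h1 := (hasDerivAt_s4 (y 0)).comp_hasFDerivAt y (hasFDerivAt_coord 0 y)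
  have h2 := (hasDerivAt_rho (y 2)).comp_hasFDerivAt y (hasFDerivAt_coord 2 y)
  have key := ((h1.mul h2).mul_const ((4 * π)⁻¹)).congr_of_eventuallyEq (f₁ := lift pot1)
    (Filter.Eventually.of_forall fun z => by
      simp only [lift_pot1, Pi.mul_apply, Function.comp_apply]; ring)
  rw [key.fderiv]
  simp only [add_apply, smul_apply, PiLp.proj_apply, smul_eq_mul, Function.comp_apply, EuclideanSpace.single,
    PiLp.single_apply]
  simp
  field_simp

/-- `∂₂Φ₂ (proj y) = c_K (ρ(y₂) - 1)`. [folklore] -/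
theorem partialDeriv_pot2 (y : (EuclideanSpace ℝ (Fin 3))) : partialDeriv 2 pot2 (proj y) = cK * (rho (y 2) - 1) := by
  have hπ : (4 : ℝ) * π ≠ 0 := by positivity
  rw [partialDeriv_proj isSmooth_pot2]
  have h1 := (hasDerivAt_s2 (y 2)).comp_hasFDerivAt y (hasFDerivAt_coord 2 y)
  have key := ((h1.const_mul cK).mul_const ((4 * π)⁻¹)).congr_of_eventuallyEq (f₁ := lift pot2)
    (Filter.Eventually.of_forall fun z => by
      simp only [lift_pot2, Function.comp_apply]; ring)
  rw [key.fderiv]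
  simp only [smul_apply, PiLp.proj_apply, smul_eq_mul, EuclideanSpace.single, PiLp.single_apply]
  simp [rho]
  field_simp
  ring

/-- `v₁ = ∂₀Φ₁ + ∂₂Φ₂`. [folklore] -/
theorem V1_eq_partialDeriv : V1 = fun x => partialDeriv 0 pot1 x + partialDeriv 2 pot2 x := by
  funext x
  obtain ⟨y, rfl⟩ := proj_surjective x
  rw [partialDeriv_pot1, partialDeriv_pot2, ← lift_apply V1, lift_V1]
  ring

/-- `∫ v₀ = 0`. [folklore] -/
theorem hasZeroMean_V0 : HasZeroMean V0 := by
  unfold HasZeroMean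
  rw [← partialDeriv_pot0]
  exact integral_partialDeriv_eq_zero_holds isSmooth_pot0 1

/-- `∫ v₁ = 0`. [folklore] -/
theorem hasZeroMean_V1 : HasZeroMean V1 := by
  unfold HasZeroMean
  rw [V1_eq_partialDeriv, integral_add (isSmooth_pot1.partialDeriv 0).integrable (isSmooth_pot2.partialDeriv 2).integrable,
    integral_partialDeriv_eq_zero_holds isSmooth_pot1 0, integral_partialDeriv_eq_zero_holds isSmooth_pot2 2, add_zero]

/-- `∫ v = 0`. [folklore] -/
theorem hasZeroMean_vfield : HasZeroMean vfield := by
  unfold HasZeroMean vfield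
  rw [integral_add ((isSmooth_V0.smul' (isSmooth_const _)).integrable) ((isSmooth_V1.smul' (isSmooth_const _)).integrable),
    integral_smul_const, integral_smul_const]
  have h0 := hasZeroMean_V0
  have h1 := hasZeroMean_V1
  unfold HasZeroMean at h0 h1
  rw [h0, h1, zero_smul, zero_smul, add_zero]


end Summit.AnomalousDissipation.AnomalousDissipation.Theorems.CrossedShearRoot

end
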